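/-
Origin: expansion seat `planner-pub-hodgecm-pv10-0`, handover 2026-08-18 (`HOME/pub-hodgecm-pv10/lean/Pv10/N15Existence.lean`, md5 b5b257cd, 126 lines);
landed by the gen-6 packager in gate run 22 as `HodgeCM/PerL34/N15Existence.lean` (import ^import Pv[0-9]+\.→import HodgeCM.PerL34. ×2).
-/
/-
Origin: planner-pub-hodgecm-pv10-0 (unit pub-hodgecm-pv10), HodgeCM publication cell, 2026-08-18.
Node N15 (PerL v5 §3.2, tex ll. 304–313): existence of "unitary Hecke characters of `L` with prescribed
components `(z/|z|)^{m_b}` at the complex places and prescribed restriction `ε^m_{L/L₀}` to `𝔸^×_{L₀}`"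
— the WHOLE inference chain of the parenthesis, over Mathlib's idele class group `C_K` (K playing `L`),
with the subgroup `𝔸^×_{L₀}L^×/L^×` abstracted as the image of a PROPER homomorphism `f : A → C_K`
(A playing `C_{L₀}`).  KERNEL.
-/
import Summits.HodgeConjecture.HodgeCM.PerL34.CharacterGluing
import Summits.HodgeConjecture.HodgeCM.PerL34.PolarDecomposition

/-!
# N15: Hecke characters with prescribed restriction and infinity type (capstone)

`NumberField.exists_unitaryHeckeCharacter_of_isProperMap`: let `f : A →* C_K` be a continuous PROPER
homomorphism (PerL: `C_{L₀} → C_L`, proper by `ProperCriterion`), `χA : A →* Circle` a continuous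
character killing `ker f` (PerL: `ε^m_{L/L₀}`, an idele CLASS character, so automatically trivial on
`L^× ∩ 𝔸^×_{L₀}L^×_∞ = L₀^×`, cf. `TensorIntersection`), `e` an infinity type COMPATIBLE with `χA` on
`f(A) ∩ (image of L^×_∞)` (PerL: "the two prescriptions agree on `L^×_{0,∞}`", i.e. `m_b ≡ m (2)`,
cf. `RealPlaceSigns`), and suppose every infinite idele class is an `f(A)`-class times a norm-one class
(`hpolar`; PerL: `z = |z|·(z/|z|)` with `|z| ∈ ℝ_{>0} ⊂ L^×_{0,v}`).  THEN there is a unitary Hecke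
character `ψ` of `K` with `ψ ∘ f = χA` and infinity type `e`.  The primed version
`exists_unitaryHeckeCharacter_of_isProperMap'` replaces `hpolar` by `hpos`: the positive-real idele
classes lie in `f(A)` (`PolarDecomposition.hpolar_of_posRealUnits_le`).

The proof is PerL's: `χA` and the ∞-type glue to a character of `B = f(A)·(image of L^×_∞)`
(`CharacterGluing`); `B = f(A)·(norm-one torus image)` is closed and the glued character is continuous
because `f` is proper and the torus is compact (`ProperImage`, `NormOneTorus`); a continuous character
of a subgroup containing the connected component extends (`HeckeCharExtensionCont`, replacing
"Pontryagin duality").  What is NOT here: the constructions of `C_{L₀} → C_L`, of `ε_{L/L₀}`, and the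
verification of `hpolar` for them (adelic base change along `L/L₀` is absent from Mathlib).
-/

set_option autoImplicit false

noncomputable section

namespace NumberField

variable (K : Type*) [Field K] [NumberField K]

/-- **N15 (PerL ll. 304–313), kernel form.** See the module docstring. -/
theorem exists_unitaryHeckeCharacter_of_isProperMap {A : Type*} [Group A] [TopologicalSpace A]
    (f : A →* IdeleClassGroup K) (hf : IsProperMap f)
    (χA : A →* Circle) (hχA : Continuous χA) (hker : ∀ a, f a = 1 → χA a = 1)
    (e : InfinitePlace K → ℤ)
    (hcompat : ∀ (a : A) (u : (InfiniteAdeleRing K)ˣ),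
      f a = infUnitsToClass K u → χA a = infinityTypeChar K e u)
    (hpolar : (infUnitsToClass K).range ≤ f.range ⊔ (torusToClass K).range) :
    ∃ ψ : UnitaryHeckeCharacter K, ψ.HasInfinityType K e ∧ ∀ a : A, ψ (f a) = χA a := by
  classical
  -- Step 1 ("trivial on `L^× ∩ …`"): `χA` factors through `f(A)`.
  obtain ⟨χ₁, hχ₁⟩ := MonoidHom.exists_range_factor f χA hker
  -- Step 2 ("the two prescriptions agree on `L^×_{0,∞}`"): compatibility on `f(A) ∩ image(L^×_∞)`.
  have hcompat' : ∀ (u : (InfiniteAdeleRing K)ˣ) (hu : infUnitsToClass K u ∈ f.range),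
      χ₁ ⟨infUnitsToClass K u, hu⟩ = infinityTypeChar K e u := by
    intro u hu
    obtain ⟨a, ha⟩ := hu
    have hx : (⟨infUnitsToClass K u, ⟨a, ha⟩⟩ : f.range) = ⟨f a, ⟨a, rfl⟩⟩ := Subtype.ext ha.symm
    rw [hx, hχ₁ a]
    exact hcompat a u ha
  -- Step 3 ("`B` is closed …"): `B = f(A) ⊔ image(L^×_∞) = f(A) ⊔ (norm-one torus image)`, and any
  -- character of `B` restricting to `χA ∘ f⁻¹` and to the ∞-type is continuous (proper ⊔ compact).
  have hBeq : (f.range ⊔ (infUnitsToClass K).range : Subgroup (IdeleClassGroup K)) =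
      f.range ⊔ (torusToClass K).range := by
    apply le_antisymm
    · exact sup_le le_sup_left hpolar
    · refine sup_le le_sup_left ?_
      rintro _ ⟨t, rfl⟩
      exact Subgroup.mem_sup_right ⟨(t : (InfiniteAdeleRing K)ˣ), rfl⟩
  have hcont : ∀ χ : (f.range ⊔ (infUnitsToClass K).range : Subgroup (IdeleClassGroup K)) →* Circle,
      (∀ (x : IdeleClassGroup K) (hx : x ∈ f.range),
        χ ⟨x, Subgroup.mem_sup_left hx⟩ = χ₁ ⟨x, hx⟩) →
      (∀ u : (InfiniteAdeleRing K)ˣ,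
        χ ⟨infUnitsToClass K u, Subgroup.mem_sup_right ⟨u, rfl⟩⟩ = infinityTypeChar K e u) →
      Continuous χ := by
    intro χ h1 h2
    -- transport to the subgroup `f(A) ⊔ torus image`
    let ι : (f.range ⊔ (torusToClass K).range : Subgroup (IdeleClassGroup K)) →*
        (f.range ⊔ (infUnitsToClass K).range : Subgroup (IdeleClassGroup K)) :=
      Subgroup.inclusion hBeq.ge
    have hχι : Continuous (χ.comp ι) := by
      rw [continuous_char_range_sup_torus_iff K f hf]
      constructor
      · have hfun : (fun a : A => (χ.comp ι) ⟨f a, Subgroup.mem_sup_left ⟨a, rfl⟩⟩) = χA := by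
          funext a
          show χ ⟨f a, _⟩ = χA a
          rw [h1 (f a) ⟨a, rfl⟩, hχ₁]
        rw [hfun]
        exact hχA
      · have hfun : (fun t : InfiniteAdeleRing.normOneTorus K =>
            (χ.comp ι) ⟨torusToClass K t, Subgroup.mem_sup_right ⟨t, rfl⟩⟩) =
            fun t : InfiniteAdeleRing.normOneTorus K =>
              infinityTypeChar K e (↑t : (InfiniteAdeleRing K)ˣ) := by
          funext t
          exact h2 (t : (InfiniteAdeleRing K)ˣ)
        rw [hfun]
        exact (continuous_infinityTypeChar K e).comp continuous_subtype_val
    have hback : Continuous (Subgroup.inclusion hBeq.le :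
        (f.range ⊔ (infUnitsToClass K).range : Subgroup (IdeleClassGroup K)) →
        (f.range ⊔ (torusToClass K).range : Subgroup (IdeleClassGroup K))) :=
      Continuous.subtype_mk continuous_subtype_val _
    have hfac : (χ : _ → Circle) = (χ.comp ι) ∘ Subgroup.inclusion hBeq.le := by
      funext x
      rfl
    rw [hfac]
    exact hχι.comp hback
  -- Step 4 ("so the character extends"): glue and extend.
  obtain ⟨ψ, hψe, hψ⟩ := exists_unitaryHeckeCharacter_of_compatible K f.range χ₁ e hcompat' hcont
  exact ⟨ψ, hψe, fun a => by rw [hψ (f a) ⟨a, rfl⟩, hχ₁]⟩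

/-- **N15, final kernel form.**  As `exists_unitaryHeckeCharacter_of_isProperMap`, with `hpolar`
replaced by the arithmetic statement `hpos`: the positive-real idele classes lie in `f(A)` (PerL:
`ℝ_{>0} ⊂ L^×_{0,v} = ℝˣ` at every infinite place of `L₀`). -/
theorem exists_unitaryHeckeCharacter_of_isProperMap' {A : Type*} [Group A] [TopologicalSpace A]
    (f : A →* IdeleClassGroup K) (hf : IsProperMap f)
    (χA : A →* Circle) (hχA : Continuous χA) (hker : ∀ a, f a = 1 → χA a = 1)
    (e : InfinitePlace K → ℤ)
    (hcompat : ∀ (a : A) (u : (InfiniteAdeleRing K)ˣ),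
      f a = infUnitsToClass K u → χA a = infinityTypeChar K e u)
    (hpos : (posRealToClass K).range ≤ f.range) :
    ∃ ψ : UnitaryHeckeCharacter K, ψ.HasInfinityType K e ∧ ∀ a : A, ψ (f a) = χA a :=
  exists_unitaryHeckeCharacter_of_isProperMap K f hf χA hχA hker e hcompat
    (hpolar_of_posRealUnits_le K f hpos)

end NumberField
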